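import Summits.CriticalPhenomena.Ising3DConformalLimit.Theses.ReflectionTwin
import Summits.CriticalPhenomena.Ising3DConformalLimit.Theorems.HyperoctahedralRPExistsScaleCovariantLimitDecimationTwoCouplingGKS
import Literature.Probability.LatticeModels.TwistCorrBoxLimit
import HarnessLib

/-!
# Stub `stub_twinBoxMonotone` of line `replica-mirror` (crux `ReflectionTwin.TwinTransparency`, stmt-CriticalPhenomena-16905)

Griffiths monotonicity of the free boxes of the (111) REFLECTION TWIN `TW(J)` of `ℤ³` at bulk `β_c(3)`: the
pair couplings on the cube `Λ_L = box 3 L` are `β_c(3)/2` on the nearest-neighbour bonds of `ℤ³` not joining the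
layers `h = 0` and `h = 1` (`h z = z₀ + z₁ + z₂`), `β_c(3)/2` on the twin bonds `{c, x}` (`h c = 0`, `h x = 1`,
`c + x ∈ {e₀, e₁, e₂}`), every bond touching the plane `h = 0` multiplied by the seam coupling `J`, and `0`
otherwise; `twinBox J L k z = ⟨∏ᵢ σ_{zᵢ}⟩_{TW(J), Λ_L}` is the `PairIsing.gibbsAvg` of the box monomial with junk
factor `0` for a site off the box. The theorem `stub_twinBoxMonotone` (registered signature, proved EXACTLY) is
the conjunction of

* (a) VOLUME MONOTONICITY for `J ≥ 0`: `L ≤ L' → twinBox J L k z ≤ twinBox J L' k z`. If some `zᵢ ∉ Λ_L` the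
  left side is `⟨0⟩ = 0 ≤` right side (GKS I, `gibbsAvg_boxMonomial₀_nonneg`). Otherwise the couplings only
  read the underlying sites, so `Λ_L ↪ Λ_{L'}` (`volIncl`) carries the couplings of `Λ_L` to those of `Λ_{L'}`;
  the `Λ_L`-average is the `Λ_{L'}`-average for the couplings with everything off `Λ_L` switched off
  (decoupling, `PairIsing.avg_comp_eq_avg_of_vanish`), and switching nonnegative couplings back on increases
  spin-product expectations (Griffiths' comparison `gibbsAvg_spinProduct_mono`) — verbatim the tree's
  `twistCorr_mono` (`Literature/Probability/LatticeModels/TwistCorrBoxLimit.lean`), Friedli–Velenik Exercise 3.12;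
* (b) MONOTONICITY IN THE SEAM COUPLING: for `0 ≤ J ≤ J'` every coupling of `TW(J)` is in absolute value below
  that of `TW(J')` (`abs_seamCoupling_le`, `criticalBeta_nonneg`), and the observable is a spin product `σ_A` or
  identically `0` (`gibbsAvg_boxMonomial₀_mono`), Friedli–Velenik Exercise 3.31;
* (c) `|twinBox J L k z| ≤ 1` (an average of a function bounded by `1`, `TwoCouplingGKS.abs_gibbsAvg_le_one`).

Sources: S. Friedli, Y. Velenik, *Statistical Mechanics of Lattice Systems* (CUP 2017), Thm. 3.20, Thm. 3.49,
Exercises 3.12, 3.16, 3.31; R. B. Griffiths, J. Math. Phys. 8 (1967). Helpers are private (the sister stub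
`ReflectionTwinTwinThresholdSeamMonotone` has the `J`-comparison for `k = 2` after `⨆_L`; its helpers are private too,
three of them are adapted here). No definitions, no named facts.
-/

noncomputable section

namespace Summit.CriticalPhenomena.Ising3DConformalLimit.Cruxes.TwinTransparency.ReplicaMirror

open scoped BigOperators Topology Manifold Classical MeasureTheory ProbabilityTheory Matrix InnerProductSpace ComplexConjugate ContinuousMap
open Filter Set Function TopologicalSpace MeasureTheory
open Literature.Probability.LatticeModels
open Summit.CriticalPhenomena.Ising3DConformalLimit.Cruxes.ExistsScaleCovariantLimit.DecimationHomotopyRate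

/-! ## The seam coupling: sign and comparison (abstract in the two decidable conditions) -/

/-- The twin coupling `β_c/2 · (J on seam bonds, 1 on bulk bonds)` (and `0` on non-bonds) is nonnegative for
`J ≥ 0` (`β_c(3) ≥ 0`). [folklore] -/
private theorem seamCoupling_nonneg {P Q : Prop} [Decidable P] [Decidable Q] {J : ℝ} (hJ : 0 ≤ J) :
    0 ≤ (if P then (criticalBeta 3 / 2) * (if Q then J else 1) else 0 : ℝ) := by
  have hβ : 0 ≤ criticalBeta 3 / 2 := div_nonneg (criticalBeta_nonneg 3) zero_le_two
  split_ifs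
  · exact mul_nonneg hβ hJ
  · exact mul_nonneg hβ zero_le_one
  · exact le_rfl

-- adapted from `ReflectionTwinTwinThresholdSeamMonotone.abs_seamCoupling_le` (private there)
/-- Entrywise comparison of the twin couplings: for `0 ≤ J ≤ J'` every coupling of `TW(J)` is, in absolute
value, at most the corresponding coupling of `TW(J')`. [folklore] -/
private theorem abs_seamCoupling_le {P Q : Prop} [Decidable P] [Decidable Q] {J J' : ℝ} (hJ : 0 ≤ J)
    (hJJ' : J ≤ J') :
    |(if P then (criticalBeta 3 / 2) * (if Q then J else 1) else 0 : ℝ)| ≤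
      (if P then (criticalBeta 3 / 2) * (if Q then J' else 1) else 0 : ℝ) := by
  have hβ : 0 ≤ criticalBeta 3 / 2 := div_nonneg (criticalBeta_nonneg 3) zero_le_two
  split_ifs
  · rw [abs_of_nonneg (mul_nonneg hβ hJ)]
    exact mul_le_mul_of_nonneg_left hJJ' hβ
  · rw [abs_of_nonneg (mul_nonneg hβ zero_le_one)]
  · rw [abs_zero]

/-! ## The box monomial with junk factor `0` -/

-- adapted from `ReflectionTwinTwinThresholdSeamMonotone.abs_boxMonomial₀_le_one` (private there)
/-- `|∏ᵢ (σ_{zᵢ} if zᵢ ∈ Λ_L else 0)| ≤ 1`. [folklore] -/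
private theorem abs_boxMonomial₀_le_one (L : ℕ) {n : ℕ} (z : Fin n → Site 3) (s : SpinConfig ↥(box 3 L)) :
    |(∏ i, if h : z i ∈ box 3 L then spinAt (⟨z i, h⟩ : ↥(box 3 L)) s else 0 : ℝ)| ≤ 1 := by
  rw [Finset.abs_prod]
  refine Finset.prod_le_one (fun _ _ => abs_nonneg _) fun i _ => ?_
  split_ifs
  · rw [abs_spinAt]
  · rw [abs_zero]; exact zero_le_one

/-- Inside the box the monomial with junk `0` is a spin product `σ_A` of box sites (`σ² = 1`). [folklore] -/
private theorem exists_boxMonomial₀_eq_spinProduct (L : ℕ) {n : ℕ} {z : Fin n → Site 3}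
    (hz : ∀ i, z i ∈ box 3 L) :
    ∃ A : Finset ↥(box 3 L), (fun s : SpinConfig ↥(box 3 L) =>
      ∏ i, if h : z i ∈ box 3 L then spinAt (⟨z i, h⟩ : ↥(box 3 L)) s else 0) = spinProduct A := by
  obtain ⟨A, hA⟩ := TwoCouplingGKS.exists_prod_spinAt_eq_spinProduct (V := ↥(box 3 L))
    (Finset.univ : Finset (Fin n)) (fun i => (⟨z i, hz i⟩ : ↥(box 3 L)))
  refine ⟨A, ?_⟩
  rw [← hA]
  funext s
  exact Finset.prod_congr rfl fun i _ => dif_pos (hz i)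

/-- Off the box the monomial with junk `0` vanishes identically. [folklore] -/
private theorem boxMonomial₀_eq_zero (L : ℕ) {n : ℕ} {z : Fin n → Site 3} {i : Fin n} (hi : z i ∉ box 3 L) :
    (fun s : SpinConfig ↥(box 3 L) =>
      ∏ i, if h : z i ∈ box 3 L then spinAt (⟨z i, h⟩ : ↥(box 3 L)) s else 0) = fun _ => 0 := by
  funext s
  exact Finset.prod_eq_zero (Finset.mem_univ i) (dif_neg hi)

/-! ## GKS I and Griffiths' comparison for the box monomial -/

/-- **GKS I**: for nonnegative couplings `⟨∏ᵢ (σ_{zᵢ} if zᵢ ∈ Λ_L else 0)⟩_c ≥ 0` (a spin product, or `0`).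
[cite: FriedliVelenik2017, Thm. 3.49, eq. (3.54)] -/
private theorem gibbsAvg_boxMonomial₀_nonneg (L : ℕ) {c : ↥(box 3 L) → ↥(box 3 L) → ℝ} (hc : ∀ a b, 0 ≤ c a b)
    {n : ℕ} (z : Fin n → Site 3) :
    0 ≤ PairIsing.gibbsAvg c
      (fun s => ∏ i, if h : z i ∈ box 3 L then spinAt (⟨z i, h⟩ : ↥(box 3 L)) s else 0) := by
  by_cases hz : ∀ i, z i ∈ box 3 L
  · obtain ⟨A, hA⟩ := exists_boxMonomial₀_eq_spinProduct L hz
    rw [hA]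
    exact TwoCouplingGKS.gibbsAvg_spinProduct_nonneg hc A
  · obtain ⟨i, hi⟩ := not_forall.1 hz
    rw [boxMonomial₀_eq_zero L hi, PairIsing.gibbsAvg_const]

-- adapted from `ReflectionTwinTwinThresholdSeamMonotone.gibbsAvg_boxMonomial₀_mono` (private there)
/-- **Griffiths' comparison for the box monomial with junk `0`**: `|c| ≤ c'` entrywise implies
`⟨∏ᵢ σ_{zᵢ}⟩_c ≤ ⟨∏ᵢ σ_{zᵢ}⟩_{c'}` (a spin product, or identically `0`). [cite: FriedliVelenik2017, Exercise 3.31, p. 142] -/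
private theorem gibbsAvg_boxMonomial₀_mono (L : ℕ) {c c' : ↥(box 3 L) → ↥(box 3 L) → ℝ}
    (hcc' : ∀ a b, |c a b| ≤ c' a b) {n : ℕ} (z : Fin n → Site 3) :
    PairIsing.gibbsAvg c (fun s => ∏ i, if h : z i ∈ box 3 L then spinAt (⟨z i, h⟩ : ↥(box 3 L)) s else 0) ≤
      PairIsing.gibbsAvg c' (fun s => ∏ i, if h : z i ∈ box 3 L then spinAt (⟨z i, h⟩ : ↥(box 3 L)) s else 0) := by
  by_cases hz : ∀ i, z i ∈ box 3 L
  · obtain ⟨A, hA⟩ := exists_boxMonomial₀_eq_spinProduct L hz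
    rw [hA]
    exact TwoCouplingGKS.gibbsAvg_spinProduct_mono hcc' A
  · obtain ⟨i, hi⟩ := not_forall.1 hz
    rw [boxMonomial₀_eq_zero L hi, PairIsing.gibbsAvg_const, PairIsing.gibbsAvg_const]

/-! ## GKS II in the volume for couplings that only read the sites -/

-- adapted from `Literature.Probability.LatticeModels.twistCorr_mono` (TwistCorrBoxLimit.lean)
/-- **Volume monotonicity (Friedli–Velenik Exercise 3.12)**: let `Λ_L ⊆ Λ_{L'}` and let the nonnegative couplings
`c'` of the large box restrict along the inclusion `volIncl` to the couplings `c` of the small box. Then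
`⟨∏ᵢ σ_{zᵢ}⟩_{c, Λ_L} ≤ ⟨∏ᵢ σ_{zᵢ}⟩_{c', Λ_{L'}}` (junk `0` off the box on both sides): off the small box the left
side is `0 ≤` right side (GKS I); inside, the small box is the large one with all couplings off it switched off
(`PairIsing.avg_comp_eq_avg_of_vanish`) and switching them on is Griffiths' comparison.
[cite: FriedliVelenik2017, Exercise 3.12, p. 112] -/
private theorem gibbsAvg_boxMonomial₀_mono_volume {L L' : ℕ} (hsub : box 3 L ⊆ box 3 L')
    {c : ↥(box 3 L) → ↥(box 3 L) → ℝ} {c' : ↥(box 3 L') → ↥(box 3 L') → ℝ} (hc' : ∀ a b, 0 ≤ c' a b)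
    (hsame : ∀ a b : ↥(box 3 L), c' (volIncl hsub a) (volIncl hsub b) = c a b) {n : ℕ} (z : Fin n → Site 3) :
    PairIsing.gibbsAvg c (fun s => ∏ i, if h : z i ∈ box 3 L then spinAt (⟨z i, h⟩ : ↥(box 3 L)) s else 0) ≤
      PairIsing.gibbsAvg c'
        (fun s => ∏ i, if h : z i ∈ box 3 L' then spinAt (⟨z i, h⟩ : ↥(box 3 L')) s else 0) := by
  by_cases hz : ∀ i, z i ∈ box 3 L
  swap
  · obtain ⟨i, hi⟩ := not_forall.1 hz
    rw [boxMonomial₀_eq_zero L hi, PairIsing.gibbsAvg_const]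
    exact gibbsAvg_boxMonomial₀_nonneg L' hc' z
  have hz' : ∀ i, z i ∈ box 3 L' := fun i => hsub (hz i)
  -- the inclusion of the small box into the large one
  let e : ↥(box 3 L) → ↥(box 3 L') := volIncl hsub
  have he : Function.Injective e := volIncl_injective hsub
  have hrange : ∀ w : ↥(box 3 L'), w ∉ Set.range e → w.1 ∉ box 3 L :=
    fun w hw hmem => hw ⟨⟨w.1, hmem⟩, rfl⟩
  -- the couplings of the large box with everything off the small box switched off
  let ct : ↥(box 3 L') → ↥(box 3 L') → ℝ := fun a b =>
    if a.1 ∈ box 3 L ∧ b.1 ∈ box 3 L then c' a b else 0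
  have hpull : (fun a b => ct (e a) (e b)) = c := by
    funext a b
    rw [← hsame a b]
    exact if_pos ⟨a.2, b.2⟩
  have hvan : ∀ a b, (a ∉ Set.range e ∨ b ∉ Set.range e) → ct a b = 0 := by
    intro a b hab
    show (if a.1 ∈ box 3 L ∧ b.1 ∈ box 3 L then c' a b else 0) = 0
    split_ifs with h
    · rcases hab with h' | h'
      · exact (hrange a h' h.1).elim
      · exact (hrange b h' h.2).elim
    · rfl
  have hcmp : ∀ a b, |ct a b| ≤ c' a b := by
    intro a b
    show |(if a.1 ∈ box 3 L ∧ b.1 ∈ box 3 L then c' a b else 0)| ≤ _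
    split_ifs
    · exact (abs_of_nonneg (hc' a b)).le
    · rw [abs_zero]; exact hc' a b
  -- the observables: the monomial of the large box restricts to the monomial of the small box
  have hobs : ∀ s : SpinConfig ↥(box 3 L'),
      (∏ i, (if h : z i ∈ box 3 L then spinAt (⟨z i, h⟩ : ↥(box 3 L)) (s ∘ e) else 0)) =
        ∏ i, (if h : z i ∈ box 3 L' then spinAt (⟨z i, h⟩ : ↥(box 3 L')) s else 0) := by
    intro s
    refine Finset.prod_congr rfl fun i _ => ?_
    rw [dif_pos (hz i), dif_pos (hz' i)]
    rfl
  calc PairIsing.gibbsAvg c (fun s => ∏ i, if h : z i ∈ box 3 L then spinAt (⟨z i, h⟩ : ↥(box 3 L)) s else 0)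
      = PairIsing.avg (fun a b => ct (e a) (e b))
          (fun s => ∏ i, if h : z i ∈ box 3 L then spinAt (⟨z i, h⟩ : ↥(box 3 L)) s else 0) := by
        rw [hpull]; rfl
    _ = PairIsing.avg ct (fun s => ∏ i,
          (if h : z i ∈ box 3 L then spinAt (⟨z i, h⟩ : ↥(box 3 L)) (s ∘ e) else 0)) :=
        (PairIsing.avg_comp_eq_avg_of_vanish he hvan _).symm
    _ = PairIsing.gibbsAvg ct
          (fun s => ∏ i, if h : z i ∈ box 3 L' then spinAt (⟨z i, h⟩ : ↥(box 3 L')) s else 0) :=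
        congrArg (PairIsing.avg ct) (funext hobs)
    _ ≤ PairIsing.gibbsAvg c'
          (fun s => ∏ i, if h : z i ∈ box 3 L' then spinAt (⟨z i, h⟩ : ↥(box 3 L')) s else 0) :=
        gibbsAvg_boxMonomial₀_mono L' hcmp z

/-! ## The registered stub -/

/-- **stub_twinBoxMonotone (S1 — GRIFFITHS MONOTONICITY OF THE FREE TWIN BOXES).**
For `J ≥ 0` the free-box twin correlator `⟨∏ᵢ σ_{zᵢ}⟩_{TW(J), box L}` (junk factor `0` for a point off the box) is
non-decreasing in the box `L` (the small box is the large one with the couplings off it switched off: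
`PairIsing.avg_comp_eq_avg_of_vanish` + Griffiths' comparison `gibbsAvg_spinProduct_mono`, exactly as
`twistCorr_mono` in `Literature/…/TwistCorrBoxLimit.lean`), non-decreasing in the seam coupling `J`
(`|cpl J| ≤ cpl J'` entrywise for `0 ≤ J ≤ J'`, `criticalBeta_nonneg`), and bounded by `1` in absolute value.
Consequences used downstream: `twinLat = lim_L = sup_L`, `twinLat` monotone in `J` (TwinThreshold's
`stub_seamMonotone` is the `k = 2` corollary). [cite: FriedliVelenik2017, Thm. 3.20, Exercises 3.12, 3.16, 3.31] -/
theorem stub_twinBoxMonotone :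
    (fun (twinBox : ℝ → ℕ → (k : ℕ) → (Fin k → Site 3) → ℝ) => (∀ (J : ℝ) (k : ℕ) (z : Fin k → Site 3) (L L' : ℕ), 0 ≤ J → L ≤ L' → twinBox J L k z ≤ twinBox J L' k z) ∧ (∀ (J J' : ℝ) (k : ℕ) (z : Fin k → Site 3) (L : ℕ), 0 ≤ J → J ≤ J' → twinBox J L k z ≤ twinBox J' L k z) ∧ (∀ (J : ℝ) (k : ℕ) (z : Fin k → Site 3) (L : ℕ), |twinBox J L k z| ≤ 1)) (fun (J : ℝ) (L : ℕ) (k : ℕ) (z : Fin k → Site 3) => PairIsing.gibbsAvg (fun a b : ↥(box 3 L) => if (((∑ i, |a.1 i - b.1 i| = 1) ∧ ¬ ((a.1 0 + a.1 1 + a.1 2 = 0 ∧ b.1 0 + b.1 1 + b.1 2 = 1) ∨ (a.1 0 + a.1 1 + a.1 2 = 1 ∧ b.1 0 + b.1 1 + b.1 2 = 0))) ∨ (((a.1 0 + a.1 1 + a.1 2 = 0 ∧ b.1 0 + b.1 1 + b.1 2 = 1) ∨ (a.1 0 + a.1 1 + a.1 2 = 1 ∧ b.1 0 + b.1 1 +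 b.1 2 = 0)) ∧ ∃ i : Fin 3, a.1 + b.1 = Pi.single i 1)) then (criticalBeta 3 / 2) * (if a.1 0 + a.1 1 + a.1 2 = 0 ∨ b.1 0 + b.1 1 + b.1 2 = 0 then J else 1) else 0) (fun s => ∏ i, if h : z i ∈ box 3 L then spinAt (⟨z i, h⟩ : ↥(box 3 L)) s else 0)) := by
  beta_reduce
  refine ⟨fun J k z L L' hJ hLL' => ?_, fun J J' k z L hJ hJJ' => ?_, fun J k z L => ?_⟩
  · -- (a) volume monotonicity: the couplings only read the underlying sites (`hsame` by `rfl`); the coupling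
    -- metavariables are assigned from the goal BEFORE the two function arguments are elaborated (`refine … ?_ ?_`)
    refine gibbsAvg_boxMonomial₀_mono_volume (box_mono 3 hLL') ?_ ?_ z
    · exact fun a b => seamCoupling_nonneg hJ
    · exact fun a b => rfl
  · -- (b) monotonicity in the seam coupling
    refine gibbsAvg_boxMonomial₀_mono L ?_ z
    exact fun a b => abs_seamCoupling_le hJ hJJ'
  · -- (c) the bound by `1`
    exact TwoCouplingGKS.abs_gibbsAvg_le_one _ fun s => abs_boxMonomial₀_le_one L z s

end Summit.CriticalPhenomena.Ising3DConformalLimit.Cruxes.TwinTransparency.ReplicaMirror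

end
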